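import Summits.Schanuel.Schanuel.Theorems.RootDecomp1BChannelCountDefs

/-!
# RootDecomp1BChannelCount — part 2/4 (Split): channel count vs relative degree, and the EXACT split SD0 ⟺ TC ∧ JI

Two CLOSED channels cap `t(r) ≤ t(r′) + 1` (`polarDeg_le_init_add_one_of_not_atMostOneClosed`), so defect zero over a sharp hyperplane needs a
SECOND open channel (TC) and then the JOINT independence of the two open channels (JI): `sharpDefectZeroAt_iff_relDeg`, `sharpDefectZeroAt_iff_channels`
(pointwise), `sharpDefectZeroStep_iff_channels`, `sharpDefectZeroGlue11_holds`.  (+ two gen-≤10 helpers never landed before: `isAlgebraic_of_mem_gens`,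
`relDeg_le_of_polarDeg_le`.)  § Gen 11 of lens 4's ChannelCount.lean (705da1e0…); `--supports stmt-Schanuel-32408`.  Sorry-free; standard axioms; rung 0.
-/

open Complex IntermediateField
open Literature.NumberTheory.Transcendental (trdeg_adjoin_le_of_le isAlgebraic_adjoin_over_algebraAdjoin nesterenko algebraicIndependent_exp_holds transcendental_pi_holds)

namespace Summit.Schanuel.Schanuel.Theorems.RootDecomp1BChannelCount

set_option linter.dupNamespace false

open Summit.Schanuel.Schanuel.Theorems.RootDecomp1BFedFlagCore (KleinIH polarDeg polarDeg_lt_aleph0 polarField polarGens two_mul_le_polarDeg_init)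
open Summit.Schanuel.Schanuel.Theorems.RootDecomp1BTameFlagCore (isAlgebraic_I isAlgebraic_of_le)
open Summit.Schanuel.Schanuel.Theorems.RootDecomp1BDefectFloorCells (lastGens polarDeg_le_init_add_of_algebraic)
open Summit.Schanuel.Schanuel.Theorems.RootDecomp1BDefectFloorChannels (one_le_relDeg_of_transcendental polarDeg_eq_init_add_relDeg relDeg
  relDeg_lt_aleph0 sharpRelativeLindemannAt_iff_relDeg)

section

variable {m : ℕ}

/-- (gen-≤10 declaration of the node; private: print-twin of `RootDecomp1DefectSplit.isAlgebraic_of_mem_gens`, gate dedup) Elements of the generating set are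
algebraic over the generated field. [lens-2] -/
private theorem isAlgebraic_of_mem_gens {S : Set ℂ} {x : ℂ} (hx : x ∈ S) :
    IsAlgebraic ↥(adjoin ℚ S) x := by
  have hx' : x ∈ adjoin ℚ S := subset_adjoin ℚ S hx
  exact isAlgebraic_algebraMap (⟨x, hx'⟩ : ↥(adjoin ℚ S))

/-- (gen-≤10 declaration of the node, never landed before; included by dependency closure) From `t(r) ≤ t(r') + k` to `relDeg ≤ k` (tower law, all degrees finite). -/
theorem relDeg_le_of_polarDeg_le {r : Fin (m + 1) → ℝ} {k : ℕ}
    (h : polarDeg r ≤ polarDeg (Fin.init r) + (k : Cardinal)) : relDeg r ≤ (k : Cardinal) := by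
  rw [polarDeg_eq_init_add_relDeg] at h
  obtain ⟨n', hn'⟩ := Cardinal.lt_aleph0.mp (polarDeg_lt_aleph0 (Fin.init r))
  obtain ⟨d, hd⟩ := Cardinal.lt_aleph0.mp (relDeg_lt_aleph0 r)
  rw [hn', hd] at h
  rw [hd]
  norm_cast at h ⊢
  omega

/-- `u, e^u` algebraic over F(r') ⟹ `t(r) ≤ t(r') + 1` (adjoin the phase channel only). -/
theorem polarDeg_le_init_add_one_of_coordinate_modulus (r : Fin (m + 1) → ℝ)
    (hu : IsAlgebraic ↥(polarField (Fin.init r)) ((r (Fin.last m) : ℝ) : ℂ))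
    (he : IsAlgebraic ↥(polarField (Fin.init r)) (Complex.exp ((r (Fin.last m) : ℝ) : ℂ))) :
    polarDeg r ≤ polarDeg (Fin.init r) + ((1 : ℕ) : Cardinal) := by
  have hKL : polarField (Fin.init r) ≤
      IntermediateField.adjoin ℚ (polarGens (Fin.init r) ∪ {Complex.exp (((r (Fin.last m) : ℝ) : ℂ) * Complex.I)}) :=
    adjoin.mono ℚ _ _ Set.subset_union_left
  have h := polarDeg_le_init_add_of_algebraic r {Complex.exp (((r (Fin.last m) : ℝ) : ℂ) * Complex.I)} ?_
  · refine h.trans (add_le_add le_rfl ?_)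
    rw [Cardinal.mk_singleton]
    exact_mod_cast le_rfl
  · intro x hx
    simp only [lastGens, Set.mem_insert_iff, Set.mem_singleton_iff] at hx
    rcases hx with rfl | rfl | rfl | rfl
    · exact isAlgebraic_of_le hKL hu
    · exact (isAlgebraic_of_le hKL hu).mul (isAlgebraic_I _)
    · exact isAlgebraic_of_le hKL he
    · exact isAlgebraic_of_mem_gens (Or.inr rfl)

/-- `u, e^{iu}` algebraic over F(r') ⟹ `t(r) ≤ t(r') + 1` (adjoin the modulus channel only). -/
theorem polarDeg_le_init_add_one_of_coordinate_phase (r : Fin (m + 1) → ℝ)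
    (hu : IsAlgebraic ↥(polarField (Fin.init r)) ((r (Fin.last m) : ℝ) : ℂ))
    (hp : IsAlgebraic ↥(polarField (Fin.init r)) (Complex.exp (((r (Fin.last m) : ℝ) : ℂ) * Complex.I))) :
    polarDeg r ≤ polarDeg (Fin.init r) + ((1 : ℕ) : Cardinal) := by
  have hKL : polarField (Fin.init r) ≤
      IntermediateField.adjoin ℚ (polarGens (Fin.init r) ∪ {Complex.exp ((r (Fin.last m) : ℝ) : ℂ)}) :=
    adjoin.mono ℚ _ _ Set.subset_union_left
  have h := polarDeg_le_init_add_of_algebraic r {Complex.exp ((r (Fin.last m) : ℝ) : ℂ)} ?_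
  · refine h.trans (add_le_add le_rfl ?_)
    rw [Cardinal.mk_singleton]
    exact_mod_cast le_rfl
  · intro x hx
    simp only [lastGens, Set.mem_insert_iff, Set.mem_singleton_iff] at hx
    rcases hx with rfl | rfl | rfl | rfl
    · exact isAlgebraic_of_le hKL hu
    · exact (isAlgebraic_of_le hKL hu).mul (isAlgebraic_I _)
    · exact isAlgebraic_of_mem_gens (Or.inr rfl)
    · exact isAlgebraic_of_le hKL hp

/-- `e^u, e^{iu}` algebraic over F(r') ⟹ `t(r) ≤ t(r') + 1` (adjoin the coordinate channel only). -/
theorem polarDeg_le_init_add_one_of_modulus_phase (r : Fin (m + 1) → ℝ)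
    (he : IsAlgebraic ↥(polarField (Fin.init r)) (Complex.exp ((r (Fin.last m) : ℝ) : ℂ)))
    (hp : IsAlgebraic ↥(polarField (Fin.init r)) (Complex.exp (((r (Fin.last m) : ℝ) : ℂ) * Complex.I))) :
    polarDeg r ≤ polarDeg (Fin.init r) + ((1 : ℕ) : Cardinal) := by
  have hKL : polarField (Fin.init r) ≤
      IntermediateField.adjoin ℚ (polarGens (Fin.init r) ∪ {((r (Fin.last m) : ℝ) : ℂ)}) :=
    adjoin.mono ℚ _ _ Set.subset_union_left
  have h := polarDeg_le_init_add_of_algebraic r {((r (Fin.last m) : ℝ) : ℂ)} ?_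
  · refine h.trans (add_le_add le_rfl ?_)
    rw [Cardinal.mk_singleton]
    exact_mod_cast le_rfl
  · intro x hx
    simp only [lastGens, Set.mem_insert_iff, Set.mem_singleton_iff] at hx
    rcases hx with rfl | rfl | rfl | rfl
    · exact isAlgebraic_of_mem_gens (Or.inr rfl)
    · exact (isAlgebraic_of_mem_gens (Or.inr rfl)).mul (isAlgebraic_I _)
    · exact isAlgebraic_of_le hKL he
    · exact isAlgebraic_of_le hKL hp

/-- TWO CLOSED CHANNELS force `t(r) ≤ t(r') + 1` … -/
theorem polarDeg_le_init_add_one_of_not_atMostOneClosed {r : Fin (m + 1) → ℝ} (h : ¬ AtMostOneClosed m r) :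
    polarDeg r ≤ polarDeg (Fin.init r) + ((1 : ℕ) : Cardinal) := by
  rw [atMostOneClosed_iff] at h
  by_cases h01 : IsAlgebraic ↥(polarField (Fin.init r)) ((r (Fin.last m) : ℝ) : ℂ) ∧
      IsAlgebraic ↥(polarField (Fin.init r)) (Complex.exp ((r (Fin.last m) : ℝ) : ℂ))
  · exact polarDeg_le_init_add_one_of_coordinate_modulus r h01.1 h01.2
  by_cases h02 : IsAlgebraic ↥(polarField (Fin.init r)) ((r (Fin.last m) : ℝ) : ℂ) ∧
      IsAlgebraic ↥(polarField (Fin.init r)) (Complex.exp (((r (Fin.last m) : ℝ) : ℂ) * Complex.I))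
  · exact polarDeg_le_init_add_one_of_coordinate_phase r h02.1 h02.2
  by_cases h12 : IsAlgebraic ↥(polarField (Fin.init r)) (Complex.exp ((r (Fin.last m) : ℝ) : ℂ)) ∧
      IsAlgebraic ↥(polarField (Fin.init r)) (Complex.exp (((r (Fin.last m) : ℝ) : ℂ) * Complex.I))
  · exact polarDeg_le_init_add_one_of_modulus_phase r h12.1 h12.2
  · exact absurd ⟨h01, h02, h12⟩ h

/-- … i.e. `relDeg r ≤ 1`; … -/
theorem relDeg_le_one_of_not_atMostOneClosed {r : Fin (m + 1) → ℝ} (h : ¬ AtMostOneClosed m r) : relDeg r ≤ 1 := by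
  exact_mod_cast relDeg_le_of_polarDeg_le (k := 1) (polarDeg_le_init_add_one_of_not_atMostOneClosed h)

/-- … contrapositively `relDeg r ≥ 2` ⟹ at most one closed channel. -/
theorem atMostOneClosed_of_two_le_relDeg {r : Fin (m + 1) → ℝ} (h : 2 ≤ relDeg r) : AtMostOneClosed m r := by
  by_contra hne
  have h1 := relDeg_le_one_of_not_atMostOneClosed hne
  obtain ⟨d, hd⟩ := Cardinal.lt_aleph0.mp (relDeg_lt_aleph0 r)
  rw [hd] at h h1
  norm_cast at h h1
  omega

/-- At most one closed channel ⟹ the floor `relDeg r ≥ 1` (u or e^u is transcendental over F(r')). -/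
theorem one_le_relDeg_of_atMostOneClosed {r : Fin (m + 1) → ℝ} (h : AtMostOneClosed m r) : 1 ≤ relDeg r := by
  have h01 := ((atMostOneClosed_iff r).mp h).1
  by_cases hu : IsAlgebraic ↥(polarField (Fin.init r)) ((r (Fin.last m) : ℝ) : ℂ)
  · exact one_le_relDeg_of_transcendental (x := Complex.exp ((r (Fin.last m) : ℝ) : ℂ)) (by simp [lastGens])
      fun he => h01 ⟨hu, he⟩
  · exact one_le_relDeg_of_transcendental (x := ((r (Fin.last m) : ℝ) : ℂ)) (by simp [lastGens]) hu

/-- SD0 READ: «over a sharp hyperplane the relative degree of (u, e^u, e^{iu}) over F(r') is never EXACTLY one». -/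
theorem sharpDefectZeroAt_iff_relDeg (r : Fin (m + 1) → ℝ) :
    SharpDefectZeroAt m r ↔ (LinearIndependent ℚ r → KleinIH (m + 1) →
      polarDeg (Fin.init r) ≤ ((m + m : ℕ) : Cardinal) → 1 ≤ relDeg r → 2 ≤ relDeg r) := by
  unfold SharpDefectZeroAt
  have htower := polarDeg_eq_init_add_relDeg r
  obtain ⟨n', hn'⟩ := Cardinal.lt_aleph0.mp (polarDeg_lt_aleph0 (Fin.init r))
  obtain ⟨d, hd⟩ := Cardinal.lt_aleph0.mp (relDeg_lt_aleph0 r)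
  obtain ⟨n, hn⟩ := Cardinal.lt_aleph0.mp (polarDeg_lt_aleph0 r)
  rw [hn', hd, hn] at htower
  rw [hn', hd, hn]
  constructor
  · intro h hr hIH hle h1
    have hIH' := two_mul_le_polarDeg_init hr hIH
    rw [hn'] at hIH'
    have h' := h hr hIH hle
    norm_cast at htower hIH' h' hle h1 ⊢
    omega
  · intro h hr hIH hle h1
    have hIH' := two_mul_le_polarDeg_init hr hIH
    rw [hn'] at hIH'
    have h' := h hr hIH hle
    norm_cast at htower hIH' h' hle h1 ⊢
    omega

/-- the floor hypothesis in relative-degree currency. -/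
theorem one_le_relDeg_of_floor {r : Fin (m + 1) → ℝ} (hr : LinearIndependent ℚ r) (hIH : KleinIH (m + 1))
    (hle : polarDeg (Fin.init r) ≤ ((m + m : ℕ) : Cardinal)) (hfl : ((m + m + 1 : ℕ) : Cardinal) ≤ polarDeg r) :
    1 ≤ relDeg r :=
  (sharpRelativeLindemannAt_iff_relDeg r).mp (fun _ _ _ => hfl) hr hIH hle

/-- … and back. -/
theorem floor_of_one_le_relDeg {r : Fin (m + 1) → ℝ} (hr : LinearIndependent ℚ r) (hIH : KleinIH (m + 1))
    (hle : polarDeg (Fin.init r) ≤ ((m + m : ℕ) : Cardinal)) (h1 : 1 ≤ relDeg r) :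
    ((m + m + 1 : ℕ) : Cardinal) ≤ polarDeg r :=
  (sharpRelativeLindemannAt_iff_relDeg r).mpr (fun _ _ _ => h1) hr hIH hle

/-- SD0 ⟹ TC pointwise: defect zero means `relDeg ≥ 2`, and two closed channels would cap it at 1. -/
theorem sharpSecondChannelAt_of_sharpDefectZero {r : Fin (m + 1) → ℝ} (h : SharpDefectZeroAt m r) :
    SharpSecondChannelAt m r := fun hr hIH hle hfl =>
  atMostOneClosed_of_two_le_relDeg
    ((sharpDefectZeroAt_iff_relDeg r).mp h hr hIH hle (one_le_relDeg_of_floor hr hIH hle hfl))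

/-- SD0 ⟹ JI pointwise: at most one closed channel supplies the floor. -/
theorem twoChannelDefectZeroAt_of_sharpDefectZero {r : Fin (m + 1) → ℝ} (h : SharpDefectZeroAt m r) :
    TwoChannelDefectZeroAt m r := fun hr hIH hle hamo =>
  h hr hIH hle (floor_of_one_le_relDeg hr hIH hle (one_le_relDeg_of_atMostOneClosed hamo))

/-- TC → JI → SD0 pointwise (the glue). -/
theorem sharpDefectZeroAt_of_channels {r : Fin (m + 1) → ℝ} (hT : SharpSecondChannelAt m r)
    (hJ : TwoChannelDefectZeroAt m r) : SharpDefectZeroAt m r := fun hr hIH hle hfl =>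
  hJ hr hIH hle (hT hr hIH hle hfl)

/-- THE SPLIT IS EXACT, pointwise: SD0 ⟺ TC ∧ JI at every `r`. -/
theorem sharpDefectZeroAt_iff_channels (r : Fin (m + 1) → ℝ) :
    SharpDefectZeroAt m r ↔ (SharpSecondChannelAt m r ∧ TwoChannelDefectZeroAt m r) :=
  ⟨fun h => ⟨sharpSecondChannelAt_of_sharpDefectZero h, twoChannelDefectZeroAt_of_sharpDefectZero h⟩,
    fun h => sharpDefectZeroAt_of_channels h.1 h.2⟩

/-- … and globally. -/
theorem sharpDefectZeroStep_iff_channels : SharpDefectZeroStep ↔ (SharpSecondChannel ∧ TwoChannelDefectZeroStep) :=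
  ⟨fun h => ⟨fun m r => sharpSecondChannelAt_of_sharpDefectZero (h m r),
      fun m r => twoChannelDefectZeroAt_of_sharpDefectZero (h m r)⟩,
    fun h m r => sharpDefectZeroAt_of_channels (h.1 m r) (h.2 m r)⟩

/-- THE GLUE ITEM HOLDS. -/
theorem sharpDefectZeroGlue11_holds : SharpDefectZeroGlue11 := fun hT hJ =>
  sharpDefectZeroStep_iff_channels.mpr ⟨hT, hJ⟩

end

end Summit.Schanuel.Schanuel.Theorems.RootDecomp1BChannelCount
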